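import Mathlib
import HarnessLib
import Summits.Ventures.LatticeQCDFlow.Exactness.SphereNLOFlowGeneratorClosed

/-!
# The source of Lüscher's order-`t²` equation for the lattice CP(N−1)/O(N) model, in closed form

HONEST FRAMING: exact (Metropolis-corrected) sampling algorithms for lattice gauge theory;
figures of merit are autocorrelation/cost numbers at stated couplings and volumes; no
continuum-physics claim.

Venture `LatticeQCDFlow` (cell pub-lqcd), topic `Exactness`; FANOUT row 7 (`s0-cpn-null`).  NEW
WORK of the cell over the tree's `Exactness/SphereNLOFlowGeneratorClosed.lean` (the collected NLO
generator `−∂̃S̃⁽¹⁾`) and `Exactness/SphereLOFlowAction.lean` (E–S eq. (13): `∂̃_k S = −2κ p_k`);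
nothing is cited as a fact.  Printed counterpart, NAMED ONLY: M. Lüscher, Commun. Math. Phys.
293 (2010) 899, §3.2 eqs. (3.9)–(3.12) (order `t²` of the recursion: `−Σ∂²S̃⁽²⁾ + Σ⟨∂S, ∂S̃⁽¹⁾⟩ =
Ċ⁽²⁾`, i.e. `𝔏₀S̃⁽²⁾ = R⁽²⁾ + Ċ⁽²⁾` with source `R⁽²⁾ = −Σ_k ⟨∂̃_k S, ∂̃_k S̃⁽¹⁾⟩`); for O(3)
with unit couplings the order-2 action is printed in Chamness–Kovner–Orginos, PoS LATTICE2023 008.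

## Content (`‖x n‖ = 1`; `p_k = tangentKick (J_k) (x k)`, `J_n = localField U n x`; no
## self-coupling, adjoint pairs; `d = dim E`)

* `inner_tangentKick_tangentKick_left` — `⟪p, P_u v⟫ = ⟪p, v⟫` for a tangent vector `p = P_u J`.
* **`nnlo_source_eq`** — THE ORDER-`t²` SOURCE IN CLOSED FORM:
  `−Σ_k ⟪∂̃_k S, ∂̃_k S̃⁽¹⁾⟫ = −(4κ³/(d−1))·Σ_k [ (2/(2d−1))⟪p_k, V_A(k)⟫ − (1/(2d−1))⟪p_k, V_B(k)⟫
  − (1/d)⟪p_k, V_C(k)⟫ ]` with the transported local fields of `SphereNLOFlowGeneratorClosed`: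
  `V_A(k) = Σ_n U_{kn}(J_n − U_{nk}x_k)`, `V_B(k) = ⟪J_k,x_k⟫J_k − Σ_m⟪U_{km}x_m,x_k⟫U_{km}x_m +
  Σ_n(⟪J_n,x_n⟫ − ⟪U_{nk}x_k,x_n⟫)U_{kn}x_n`, `V_C(k) = Σ_m⟪U_{km}x_m,x_k⟫U_{km}x_m` — a quartic
  lattice polynomial supported on paths of length `≤ 3`.  With `SphereLatticeLuscherKernel`
  (uniqueness), `SphereLatticeLuscherStability` (`Var_π(S̃⁽²⁾) ≤ Var_π(R⁽²⁾)/(d−1)²`) and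
  `SphereLatticePoissonSolver` (solvability in a stable space) this is the typed input of order 2.

NOT CLAIMED: the order-2 action `S̃⁽²⁾` itself (its closed form needs the inversion of `𝔏₀` on
cubic/quartic lattice polynomials, not done here); anything quantitative.
-/

noncomputable section

namespace Summit.Ventures.LatticeQCDFlow.Exactness

open NormedSpace Filter InnerProductSpace
open scoped RealInnerProductSpace Topology Gradient

variable {E : Type*} [NormedAddCommGroup E] [InnerProductSpace ℝ E]
variable {Λ : Type*} [Fintype Λ] [DecidableEq Λ]

omit [Fintype Λ] [DecidableEq Λ] in
/-- **A tangent vector does not see the projection**: `⟪P_u J, P_u v⟫ = ⟪P_u J, v⟫` for `‖u‖ = 1`. -/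
theorem inner_tangentKick_tangentKick_left {u : E} (hu : ‖u‖ = 1) (J v : E) :
    ⟪tangentKick J u, tangentKick v u⟫ = ⟪tangentKick J u, v⟫ := by
  have h0 : ⟪tangentKick J u, u⟫ = 0 := by rw [real_inner_comm]; exact inner_self_tangentKick J hu
  conv_lhs => rw [show tangentKick v u = v - ⟪v, u⟫ • u from rfl]
  rw [inner_sub_right, inner_smul_right, h0, mul_zero, sub_zero]

variable [FiniteDimensional ℝ E] {U : Λ → Λ → (E →L[ℝ] E)}

/-- **THE SOURCE OF LÜSCHER'S ORDER-`t²` EQUATION, in closed form.**  On the product of unit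
spheres, with no self-coupling and adjoint-pair couplings,
`−Σ_k ⟪∂̃_k S, ∂̃_k S̃⁽¹⁾⟫ = −(4κ³/(d−1)) Σ_k [(2/(2d−1))⟪p_k, V_A(k)⟫ − (1/(2d−1))⟪p_k, V_B(k)⟫ −
(1/d)⟪p_k, V_C(k)⟫]` (`p_k = P_{x_k} J_k`; `V_A, V_B, V_C` the transported local fields of
`siteGrad_stapleSum / _crossSum / _squareSum`). -/
theorem nnlo_source_eq (hU0 : ∀ n, U n n = 0)
    (hUadj : ∀ m n (v w : E), ⟪U m n v, w⟫ = ⟪v, U n m w⟫) (hd : 2 ≤ Module.finrank ℝ E)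
    (κ S₀ : ℝ) {x : Λ → E} (hx : ∀ n, ‖x n‖ = 1) :
    -∑ k, ⟪siteGrad k (esAction κ S₀ U) x, siteGrad k (nloFlowAction κ U) x⟫ =
      -(4 * κ ^ 3 / ((Module.finrank ℝ E : ℝ) - 1)) * ∑ k,
        ((2 / (2 * (Module.finrank ℝ E : ℝ) - 1)) *
            ⟪tangentKick (localField U k x) (x k),
              ∑ n, U k n (localField U n x - U n k (x k))⟫ -
          (1 / (2 * (Module.finrank ℝ E : ℝ) - 1)) *
            ⟪tangentKick (localField U k x) (x k),
              ⟪localField U k x, x k⟫ • localField U k x -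
                ∑ m, ⟪U k m (x m), x k⟫ • U k m (x m) +
                ∑ n, (⟪localField U n x, x n⟫ - ⟪U n k (x k), x n⟫) • U k n (x n)⟫ -
          (1 / (Module.finrank ℝ E : ℝ)) *
            ⟪tangentKick (localField U k x) (x k), ∑ m, ⟪U k m (x m), x k⟫ • U k m (x m)⟫) := by
  have hd' : (2 : ℝ) ≤ Module.finrank ℝ E := by exact_mod_cast hd
  have hd1 : ((Module.finrank ℝ E : ℝ) - 1) ≠ 0 := by linarith
  have hd2 : (2 * (Module.finrank ℝ E : ℝ) - 1) ≠ 0 := by linarith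
  have hd0 : (Module.finrank ℝ E : ℝ) ≠ 0 := by linarith
  -- the two site gradients
  have hS : ∀ k, siteGrad k (esAction κ S₀ U) x = -(2 * κ) • tangentKick (localField U k x) (x k) :=
    fun k => siteGrad_esAction hU0 hUadj κ S₀ (hx k)
  have hT : ∀ k, siteGrad k (nloFlowAction κ U) x =
      -((2 * κ ^ 2 / ((Module.finrank ℝ E : ℝ) - 1)) • siteGrad k (nloPotential U) x) := by
    intro k
    rw [← nloGenerator_eq κ hx k, neg_neg]
  simp_rw [hS, hT, inner_neg_right, inner_smul_left, inner_smul_right,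
    siteGrad_nloPotential hU0 hUadj hx, inner_sub_right, inner_smul_right,
    inner_tangentKick_tangentKick_left (hx _)]
  simp only [RCLike.conj_to_real, Finset.mul_sum, ← Finset.sum_neg_distrib]
  refine Finset.sum_congr rfl fun k _ => ?_
  field_simp
  ring

end Summit.Ventures.LatticeQCDFlow.Exactness

end
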